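import Literature.RingTheory.CohomologyAnnihilator.NoetherDifferent
import Mathlib.RingTheory.Unramified.Field
import Mathlib.RingTheory.Ideal.IdempotentFG
import HarnessLib

/-!
# The noether different of an unramified / separable algebra is the unit ideal

Topic: `Literature/RingTheory/CohomologyAnnihilator`. [IyengarTakahashi2014, Lemma 3.5] rests on
the fact (Auslander–Goldman, Prop. 1.1) that a SEPARABLE algebra has noether different equal
to its whole centre. For a commutative algebra `B` essentially of finite type over `A`,
"separable" is "formally unramified" (`Ω[B/A] = 0`), and the statement becomes:

* `noetherDifferent_eq_top_of_formallyUnramified` — if `B` is essentially of finite type and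
  formally unramified over `A` then `𝔑(B/A) = B`. Proof: `Ker μ ⊆ B ⊗_A B` is finitely generated
  (`KaehlerDifferential.ideal_fg`) and idempotent (`Ω[B/A] = Ker μ / (Ker μ)² = 0`), hence
  generated by an idempotent `e` (Mathlib); then `1 - e` annihilates `Ker μ` and `μ(1 - e) = 1`.
* `noetherDifferent_eq_top_of_isSeparable` — in particular for a finite separable field extension
  `L/K` (`Algebra.FormallyUnramified.of_isSeparable`), `𝔑(L/K) = L`: the case used in the proof
  of Lemma 3.5 / Theorem 3.6 of [IyengarTakahashi2014] ("`Q ⊗_A Λ` is separable over `Q`").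

## References

* S. B. Iyengar, R. Takahashi, *Annihilation of cohomology and strong generation of module
  categories*, IMRN 2016; arXiv:1404.1476 — Lemma 3.5 and the paragraph before it.
  [`IyengarTakahashi2014`]
-/

noncomputable section

open scoped TensorProduct

universe u

namespace Literature.RingTheory.CohomologyAnnihilator

variable (A : Type u) [CommRing A] (B : Type u) [CommRing B] [Algebra A B]

/-- **A formally unramified algebra essentially of finite type has noether different `(1)`**
("an `A`-algebra `Λ` is separable if `𝔑(Λ/A) = Z(Λ)`", Auslander–Goldman; for commutative `B`
essentially of finite type, unramified ⇒ separable in this sense): `Ker μ` is finitely generated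
and idempotent, so `Ker μ = (e)` with `e² = e`; `1 - e ∈ ann(Ker μ)` and `μ(1 - e) = 1`.
[cite: IyengarTakahashi2014, Lemma 3.5] -/
theorem noetherDifferent_eq_top_of_formallyUnramified [Algebra.EssFiniteType A B]
    [Algebra.FormallyUnramified A B] : noetherDifferent A B = ⊤ := by
  obtain ⟨e, he, hsp⟩ : ∃ e, IsIdempotentElem e ∧
      KaehlerDifferential.ideal A B = Ideal.span {e} :=
    (Ideal.isIdempotentElem_iff_of_fg _ (KaehlerDifferential.ideal_fg A B)).mp <|
      (Ideal.cotangent_subsingleton_iff _).mp <| inferInstanceAs <| Subsingleton Ω[B⁄A]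
  rw [Ideal.eq_top_iff_one, mem_noetherDifferent_iff_exists_mem_annihilator]
  refine ⟨1 - e, ?_, ?_⟩
  · rw [Submodule.mem_annihilator]
    intro i hi
    rw [hsp, Ideal.mem_span_singleton'] at hi
    obtain ⟨r, rfl⟩ := hi
    rw [smul_eq_mul, mul_left_comm, sub_mul, one_mul, he.eq, sub_self, mul_zero]
  · have hε : Algebra.TensorProduct.lmul' (S := B) A e = 0 := by
      have : e ∈ KaehlerDifferential.ideal A B := by
        rw [hsp]; exact Ideal.mem_span_singleton_self e
      exact this
    rw [map_sub, map_one, hε, sub_zero]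

/-- **Finite separable field extensions have noether different `(1)`**: for `L/K` finite
separable, `𝔑(L/K) = L` (such `L` is formally unramified over `K`,
`Algebra.FormallyUnramified.of_isSeparable`). This is the separability input
"`Q ⊗_A Λ` is separable over `Q`" of a separable Noether normalisation in
[IyengarTakahashi2014, §3]. [cite: IyengarTakahashi2014, Lemma 3.5] -/
theorem noetherDifferent_eq_top_of_isSeparable (K : Type u) [Field K] (L : Type u) [Field L]
    [Algebra K L] [FiniteDimensional K L] [Algebra.IsSeparable K L] :
    noetherDifferent K L = ⊤ := by
  haveI : Algebra.FormallyUnramified K L := Algebra.FormallyUnramified.of_isSeparable K L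
  exact noetherDifferent_eq_top_of_formallyUnramified K L

end Literature.RingTheory.CohomologyAnnihilator

end
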